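import Literature.MathematicalPhysics.StatisticalMechanics.BarlowStackingEnergy
import Literature.MathematicalPhysics.StatisticalMechanics.PeriodicConfigurationSums
import Literature.MathematicalPhysics.StatisticalMechanics.LennardJonesClusters
import Summits.AtomisticToContinuum.Crystallization.Theses.MinMeanCycleStackingLock

/-!
# Route MinMeanCycleStackingLock — `BarlowEnergyIdentification` (stmt-AtomisticToContinuum-3065)

The layer bookkeeping left open in `BarlowStackingEnergy.lean` ("Not proved here"): for `a, h > 0`
and a `p`-periodic Hägg sequence `s`, the energy per particle
(`PeriodicConfiguration.energyPerParticle`, a `tsum` over the point set) of the periodic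
configuration `barlowPeriodicConfiguration s ha hh hp hs` for the Lennard-Jones potential equals
`barlowBaseEnergy lennardJones a h + haggEnergy p (barlowCoupling lennardJones a h) s / p`.

Proof: the motif is `{barlowPos a h s m 0 0 : m < p}` (`p` distinct points), the point set is
`barlowStacking a h s` (`barlowPeriodicConfiguration_points`), which is parametrised bijectively by
`ℤ × ℤ × ℤ` through `barlowPos` (`le_dist_barlowPos`); the Lennard-Jones sum over it is absolutely
summable (`PeriodicConfiguration.summable_lennardJones_dist_three`), so it may be computed layer by
layer (`Summable.tsum_prod`) and split into the layer of the base point, the layers above and the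
layers below (`tsum_of_add_one_of_neg_add_one`), which is `2 · barlowSiteEnergy`. The same
summability, applied to the Bravais lattice `ℤ u + ℤ v + ℤ h e₃` (the stacking of the zero
sequence) seen from the points `-δ w`, gives the summability over the layer distance of the
aligned / non-aligned layer interactions that `barlowSiteEnergy_average_eq_haggEnergy` consumes.
-/

noncomputable section

namespace Summit.AtomisticToContinuum.Crystallization.Theorems

open Finset
open Literature.MathematicalPhysics.StatisticalMechanics
open Summit.AtomisticToContinuum.Crystallization.Theses.MinMeanCycleStackingLock

section Stacking

variable {a h : ℝ} {s : ℤ → ℤ} {p : ℕ}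

/-- For `a, h > 0` the parametrisation `(k, i, j) ↦ barlowPos a h s k i j` of a Barlow stacking
is injective (distinct indices give points at distance `≥ min a h > 0`). [folklore] -/
theorem barlowPos_injective (ha : 0 < a) (hh : 0 < h) (s : ℤ → ℤ) :
    Function.Injective fun q : ℤ × ℤ × ℤ => barlowPos a h s q.1 q.2.1 q.2.2 := by
  intro q q' hqq'
  by_contra hne
  have hle := le_dist_barlowPos a h s ha.le hh.le (k := q.1) (i := q.2.1) (j := q.2.2)
    (k' := q'.1) (i' := q'.2.1) (j' := q'.2.2) hne
  have h0 : barlowPos a h s q.1 q.2.1 q.2.2 = barlowPos a h s q'.1 q'.2.1 q'.2.2 := hqq'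
  rw [h0, dist_self] at hle
  exact absurd hle (not_le.2 (lt_min ha hh))

/-- **Summability of the Lennard-Jones sum over a Barlow stacking, in the parametrisation by
`ℤ³`.** For `a, h > 0`, a `p`-periodic sequence `s` (`p ≠ 0`) and any point `x`,
`(k, i, j) ↦ V_LJ (dist x (barlowPos a h s k i j))` is summable (the point set of the periodic
configuration `barlowPeriodicConfiguration` is the stacking, and Lennard-Jones sums over periodic
configurations of `ℝ³` converge absolutely). [folklore] -/
theorem summable_lennardJones_barlowPos (ha : 0 < a) (hh : 0 < h) (ha' : a ≠ 0) (hh' : h ≠ 0)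
    (hp : p ≠ 0) (hs : ∀ i, s (i + p) = s i) (x : EuclideanSpace ℝ (Fin 3)) :
    Summable fun q : ℤ × ℤ × ℤ => lennardJones (dist x (barlowPos a h s q.1 q.2.1 q.2.2)) := by
  set P := barlowPeriodicConfiguration s ha' hh' hp hs with hPdef
  have hP : P.points = barlowStacking a h s := barlowPeriodicConfiguration_points s ha' hh' hp hs
  have hF := P.summable_lennardJones_dist_three x
  set g : ℤ × ℤ × ℤ → EuclideanSpace ℝ (Fin 3) := fun q => barlowPos a h s q.1 q.2.1 q.2.2
    with hgdef
  have hg : Function.Injective g := barlowPos_injective ha hh s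
  -- the (at most one) index whose point is `x` itself
  have hS : (g ⁻¹' {x}).Finite := (Set.subsingleton_singleton.preimage hg).finite
  have hmem : ∀ q, g q ∈ P.points := fun q => by
    rw [hP]
    exact barlowPos_mem _ _ _
  let φ : ↥(g ⁻¹' {x})ᶜ → {y // y ∈ P.points ∧ y ≠ x} :=
    fun c => ⟨g c.1, hmem c.1, fun hc => c.2 hc⟩
  have hφ : Function.Injective φ := by
    intro c c' hcc'
    have h1 : g c.1 = g c'.1 := congrArg Subtype.val hcc'
    exact Subtype.ext (hg h1)
  have h1 : Summable ((fun y : {y // y ∈ P.points ∧ y ≠ x} => lennardJones (dist x y.1)) ∘ φ) :=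
    hF.comp_injective hφ
  have h2 : Summable ((fun q : ℤ × ℤ × ℤ => lennardJones (dist x (g q))) ∘
      ((↑) : ↥(g ⁻¹' {x})ᶜ → ℤ × ℤ × ℤ)) := h1
  exact hS.summable_compl_iff.1 h2

/-- **The punctured Lennard-Jones sum over the stacking seen from a stacking point is the full
`ℤ³`-parametrised sum** (the bijection `barlowPos`; the missing diagonal term is `V_LJ(0) = 0`).
[folklore] -/
theorem tsum_points_eq_tsum_barlowPos (ha : 0 < a) (hh : 0 < h) (ha' : a ≠ 0) (hh' : h ≠ 0)
    (hp : p ≠ 0) (hs : ∀ i, s (i + p) = s i) (m : ℤ) :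
    ∑' y : {y // y ∈ (barlowPeriodicConfiguration s ha' hh' hp hs).points ∧
        y ≠ barlowPos a h s m 0 0}, lennardJones (dist (barlowPos a h s m 0 0) y.1) =
      ∑' q : ℤ × ℤ × ℤ,
        lennardJones (dist (barlowPos a h s m 0 0) (barlowPos a h s q.1 q.2.1 q.2.2)) := by
  set P := barlowPeriodicConfiguration s ha' hh' hp hs with hPdef
  have hP : P.points = barlowStacking a h s := barlowPeriodicConfiguration_points s ha' hh' hp hs
  set g : ℤ × ℤ × ℤ → EuclideanSpace ℝ (Fin 3) := fun q => barlowPos a h s q.1 q.2.1 q.2.2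
    with hgdef
  have hg : Function.Injective g := barlowPos_injective ha hh s
  set q₀ : ℤ × ℤ × ℤ := (m, 0, 0) with hq₀
  have hx : g q₀ = barlowPos a h s m 0 0 := rfl
  have hmem : ∀ q, g q ∈ P.points := fun q => by
    rw [hP]
    exact barlowPos_mem _ _ _
  let φ : ↥({q₀}ᶜ : Set (ℤ × ℤ × ℤ)) → {y // y ∈ P.points ∧ y ≠ barlowPos a h s m 0 0} :=
    fun c => ⟨g c.1, hmem c.1, fun hc => c.2 (hg (hc.trans hx.symm))⟩
  have hφ : Function.Injective φ := by
    intro c c' hcc'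
    have h1 : g c.1 = g c'.1 := congrArg Subtype.val hcc'
    exact Subtype.ext (hg h1)
  -- `φ` is onto: every point of the stacking is some `barlowPos k i j`
  have hsurj : Function.support
      (fun y : {y // y ∈ P.points ∧ y ≠ barlowPos a h s m 0 0} =>
        lennardJones (dist (barlowPos a h s m 0 0) y.1)) ⊆ Set.range φ := by
    intro y _
    have hy : y.1 ∈ barlowStacking a h s := by
      rw [← hP]
      exact y.2.1
    obtain ⟨k, i, j, hk⟩ := hy
    have hne : ((k, i, j) : ℤ × ℤ × ℤ) ∈ ({q₀}ᶜ : Set (ℤ × ℤ × ℤ)) := by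
      intro hq
      have hq' : g (k, i, j) = g q₀ := by rw [Set.mem_singleton_iff.1 hq]
      exact y.2.2 (hk.trans (hq'.trans hx))
    exact ⟨⟨(k, i, j), hne⟩, Subtype.ext hk.symm⟩
  have key := hφ.tsum_eq hsurj
  rw [← key]
  have h0 : Function.support (fun q : ℤ × ℤ × ℤ =>
      lennardJones (dist (barlowPos a h s m 0 0) (g q))) ⊆ ({q₀}ᶜ : Set (ℤ × ℤ × ℤ)) := by
    intro q hq
    rw [Function.mem_support] at hq
    simp only [Set.mem_compl_iff, Set.mem_singleton_iff]
    rintro rfl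
    exact hq (by simp only [hx, dist_self, lennardJones_zero])
  exact tsum_subtype_eq_of_support_subset h0

/-- **The Lennard-Jones energy of a site of layer `m`, as a sum over the stacking**: the punctured
sum `∑_{y ≠ x} V_LJ(|x - y|)` over the point set of `barlowPeriodicConfiguration`, for
`x = barlowPos a h s m 0 0`, equals `2 · barlowSiteEnergy lennardJones a h s m` (the same sum
organised layer by layer). [folklore] -/
theorem tsum_points_eq_two_mul_barlowSiteEnergy (ha : 0 < a) (hh : 0 < h) (ha' : a ≠ 0)
    (hh' : h ≠ 0) (hp : p ≠ 0) (hs : ∀ i, s (i + p) = s i) (m : ℤ) :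
    ∑' y : {y // y ∈ (barlowPeriodicConfiguration s ha' hh' hp hs).points ∧
        y ≠ barlowPos a h s m 0 0}, lennardJones (dist (barlowPos a h s m 0 0) y.1) =
      2 * barlowSiteEnergy lennardJones a h s m := by
  have hF := summable_lennardJones_barlowPos ha hh ha' hh' hp hs (barlowPos a h s m 0 0)
  -- layer by layer: the fibre over `k` is `layerInteraction (L k - L m) (k - m)`
  have e2 : ∑' q : ℤ × ℤ × ℤ,
      lennardJones (dist (barlowPos a h s m 0 0) (barlowPos a h s q.1 q.2.1 q.2.2)) =
      ∑' k : ℤ, layerInteraction lennardJones a h (haggLabel s k - haggLabel s m) (k - m) :=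
    hF.tsum_prod.trans (tsum_congr fun k => tsum_layer lennardJones a h s m k)
  have hG : Summable fun k : ℤ =>
      layerInteraction lennardJones a h (haggLabel s k - haggLabel s m) (k - m) :=
    hF.prod.congr fun k => tsum_layer lennardJones a h s m k
  -- recentre at `m` and split into `k = m`, `k > m`, `k < m`
  have e1 : ∑' k : ℤ, layerInteraction lennardJones a h (haggLabel s k - haggLabel s m) (k - m) =
      ∑' t : ℤ, layerInteraction lennardJones a h (haggLabel s (m + t) - haggLabel s m)
        (m + t - m) :=
    ((Equiv.addLeft m).tsum_eq fun k =>
      layerInteraction lennardJones a h (haggLabel s k - haggLabel s m) (k - m)).symm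
  have hG' : Summable fun t : ℤ =>
      layerInteraction lennardJones a h (haggLabel s (m + t) - haggLabel s m) (m + t - m) :=
    hG.comp_injective (Equiv.addLeft m).injective
  have h1 : Summable fun n : ℕ => layerInteraction lennardJones a h
      (haggLabel s (m + ((n : ℤ) + 1)) - haggLabel s m) (m + ((n : ℤ) + 1) - m) :=
    hG'.comp_injective (i := fun n : ℕ => (n : ℤ) + 1)
      fun n n' (hn : (n : ℤ) + 1 = (n' : ℤ) + 1) => by omega
  have h2 : Summable fun n : ℕ => layerInteraction lennardJones a h
      (haggLabel s (m + -((n : ℤ) + 1)) - haggLabel s m) (m + -((n : ℤ) + 1) - m) :=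
    hG'.comp_injective (i := fun n : ℕ => -((n : ℤ) + 1))
      fun n n' (hn : -((n : ℤ) + 1) = -((n' : ℤ) + 1)) => by omega
  have e3 : ∑' t : ℤ, layerInteraction lennardJones a h (haggLabel s (m + t) - haggLabel s m)
        (m + t - m) =
      (∑' n : ℕ, layerInteraction lennardJones a h
        (haggLabel s (m + ((n : ℤ) + 1)) - haggLabel s m) (m + ((n : ℤ) + 1) - m)) +
      layerInteraction lennardJones a h (haggLabel s (m + 0) - haggLabel s m) (m + 0 - m) +
      ∑' n : ℕ, layerInteraction lennardJones a h
        (haggLabel s (m + -((n : ℤ) + 1)) - haggLabel s m) (m + -((n : ℤ) + 1) - m) :=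
    tsum_of_add_one_of_neg_add_one (f := fun t : ℤ =>
      layerInteraction lennardJones a h (haggLabel s (m + t) - haggLabel s m) (m + t - m)) h1 h2
  -- identify the three pieces with those of `barlowSiteEnergy`
  have e0 : layerInteraction lennardJones a h (haggLabel s (m + 0) - haggLabel s m) (m + 0 - m) =
      ∑' ij : ℤ × ℤ, (if ij = 0 then 0 else
        lennardJones (dist (barlowPos a h s m 0 0) (barlowPos a h s m ij.1 ij.2))) := by
    rw [add_zero, sub_self, sub_self, tsum_inLayer, layerInteraction, inLayerInteraction]
    refine tsum_congr fun ij => ?_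
    split_ifs with hij
    · subst hij
      simp [layerVec, lennardJones_zero]
    · rw [layerVec_zero_zero]
  have eB : (∑' n : ℕ, layerInteraction lennardJones a h
        (haggLabel s (m + ((n : ℤ) + 1)) - haggLabel s m) (m + ((n : ℤ) + 1) - m)) =
      ∑' k : ℕ, ∑' ij : ℤ × ℤ, lennardJones
        (dist (barlowPos a h s m 0 0) (barlowPos a h s (m + (k + 1 : ℕ)) ij.1 ij.2)) :=
    tsum_congr fun n => by
      rw [tsum_layer]
      have : m + ((n : ℤ) + 1) = m + ((n + 1 : ℕ) : ℤ) := by push_cast; ring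
      rw [this]
  have eC : (∑' n : ℕ, layerInteraction lennardJones a h
        (haggLabel s (m + -((n : ℤ) + 1)) - haggLabel s m) (m + -((n : ℤ) + 1) - m)) =
      ∑' k : ℕ, ∑' ij : ℤ × ℤ, lennardJones
        (dist (barlowPos a h s m 0 0) (barlowPos a h s (m - (k + 1 : ℕ)) ij.1 ij.2)) :=
    tsum_congr fun n => by
      rw [tsum_layer]
      have : m + -((n : ℤ) + 1) = m - ((n + 1 : ℕ) : ℤ) := by push_cast; ring
      rw [this]
  rw [tsum_points_eq_tsum_barlowPos ha hh ha' hh' hp hs m, e2, e1, e3, e0, eB, eC, barlowSiteEnergy]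
  ring

/-- **Energy per particle of a periodic Barlow stacking = average site energy over a period**:
`e(barlowPeriodicConfiguration) = p⁻¹ ∑_{m<p} barlowSiteEnergy m` for Lennard-Jones (the motif
consists of the `p` distinct points `barlowPos a h s m 0 0`, `m < p`). [folklore] -/
theorem energyPerParticle_barlow_eq_average (ha : 0 < a) (hh : 0 < h) (ha' : a ≠ 0) (hh' : h ≠ 0)
    (hp : p ≠ 0) (hs : ∀ i, s (i + p) = s i) :
    (barlowPeriodicConfiguration s ha' hh' hp hs).energyPerParticle lennardJones =
      (∑ m ∈ range p, barlowSiteEnergy lennardJones a h s m) / p := by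
  set P := barlowPeriodicConfiguration s ha' hh' hp hs with hPdef
  have hmotif : P.motif = (range p).image fun m : ℕ => barlowPos a h s m 0 0 := by
    ext y
    simp only [hPdef, barlowPeriodicConfiguration, Finset.mem_image, Finset.mem_range]
  have hinj : Function.Injective fun m : ℕ => barlowPos a h s m 0 0 := by
    intro m m' hmm'
    have h2 := congrArg (fun v : EuclideanSpace ℝ (Fin 3) => v 2) hmm'
    simp only [barlowPos_apply_two, Int.cast_natCast] at h2
    exact_mod_cast mul_right_cancel₀ hh' h2
  have e : ∑ x ∈ (range p).image (fun m : ℕ => barlowPos a h s m 0 0),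
      ∑' y : {y // y ∈ P.points ∧ y ≠ x}, lennardJones (dist x y.1) =
      ∑ m ∈ range p, ∑' y : {y // y ∈ P.points ∧ y ≠ barlowPos a h s m 0 0},
        lennardJones (dist (barlowPos a h s m 0 0) y.1) :=
    Finset.sum_image fun x _ y _ hxy => hinj hxy
  have hsum : ∑ m ∈ range p, ∑' y : {y // y ∈ P.points ∧ y ≠ barlowPos a h s m 0 0},
        lennardJones (dist (barlowPos a h s m 0 0) y.1) =
      ∑ m ∈ range p, 2 * barlowSiteEnergy lennardJones a h s m :=
    Finset.sum_congr rfl fun m _ => tsum_points_eq_two_mul_barlowSiteEnergy ha hh ha' hh' hp hs m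
  rw [PeriodicConfiguration.energyPerParticle, hmotif, Finset.card_image_of_injective _ hinj,
    Finset.card_range, e, hsum, ← Finset.mul_sum]
  ring

end Stacking

/-! ## Summability of the layer interactions over the layer distance -/

/-- The zero sequence has all layer labels `0` (its "stacking" is the Bravais lattice
`ℤ u + ℤ v + ℤ h e₃`). [folklore] -/
theorem haggLabel_zero_seq (k : ℤ) : haggLabel (fun _ : ℤ => (0 : ℤ)) k = 0 := by
  unfold haggLabel haggWindow
  simp

/-- Seen from the point `-δ w`, the point `(k, i, j)` of the Bravais lattice `ℤ u + ℤ v + ℤ h e₃`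
is at distance `‖layerVec a h δ k i j‖`. [folklore] -/
theorem dist_neg_smul_barlowOffset_barlowPos (a h : ℝ) (δ k i j : ℤ) :
    dist (-((δ : ℝ) • barlowOffset a)) (barlowPos a h (fun _ : ℤ => (0 : ℤ)) k i j) =
      ‖layerVec a h δ k i j‖ := by
  rw [dist_comm, dist_eq_norm]
  congr 1
  simp only [barlowPos, layerVec, haggLabel_zero_seq, Int.cast_zero, zero_smul, add_zero,
    sub_neg_eq_add]
  module

/-- **The layer interactions of Lennard-Jones are summable over the layer distance**: for
`a, h > 0` and every lateral offset `δ`, `k ↦ layerInteraction lennardJones a h δ k` is summable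
over `k : ℕ` (the full sum over `(k, i, j) ∈ ℤ³` is the Lennard-Jones sum of the Bravais lattice
`ℤ u + ℤ v + ℤ h e₃` seen from `-δ w`, absolutely convergent in `ℝ³`). In particular the aligned
(`δ = 0`) and non-aligned (`δ = 1`) interactions `Φ_A`, `Φ_N` are summable. [folklore] -/
theorem summable_layerInteraction_lennardJones {a h : ℝ} (ha : 0 < a) (hh : 0 < h) (δ : ℤ) :
    Summable fun k : ℕ => layerInteraction lennardJones a h δ k := by
  have hs : ∀ i : ℤ, (fun _ : ℤ => (0 : ℤ)) (i + (1 : ℕ)) = (fun _ : ℤ => (0 : ℤ)) i :=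
    fun _ => rfl
  have hF := summable_lennardJones_barlowPos (s := fun _ : ℤ => (0 : ℤ)) (p := 1) ha hh ha.ne'
    hh.ne' one_ne_zero hs (-((δ : ℝ) • barlowOffset a))
  have hG : Summable fun k : ℤ => layerInteraction lennardJones a h δ k := by
    refine hF.prod.congr fun k => ?_
    show ∑' ij : ℤ × ℤ, lennardJones (dist (-((δ : ℝ) • barlowOffset a))
      (barlowPos a h (fun _ : ℤ => (0 : ℤ)) k ij.1 ij.2)) = layerInteraction lennardJones a h δ k
    unfold layerInteraction
    exact tsum_congr fun ij => by rw [dist_neg_smul_barlowOffset_barlowPos]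
  exact hG.comp_injective Nat.cast_injective

/-- **`BarlowEnergyIdentification`** (item stmt-AtomisticToContinuum-3065 of route
MinMeanCycleStackingLock; identical signature in PoissonBesselStacking, KarpPeierlsStackingLock,
LuttingerTiszaRegistry): for `a, h > 0` and a `p`-periodic Hägg sequence `s`, the energy per
particle of `barlowPeriodicConfiguration s` for Lennard-Jones is
`barlowBaseEnergy lennardJones a h + haggEnergy p (barlowCoupling lennardJones a h) s / p`.
[folklore] -/
theorem barlowEnergyIdentification_proof : BarlowEnergyIdentification := by
  intro a h ha hh s p ha' hh' hp hs hHagg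
  rw [energyPerParticle_barlow_eq_average ha hh ha' hh' hp hs]
  exact barlowSiteEnergy_average_eq_haggEnergy lennardJones a h hHagg hp hs
    (summable_layerInteraction_lennardJones ha hh 0) (summable_layerInteraction_lennardJones ha hh 1)

end Summit.AtomisticToContinuum.Crystallization.Theorems

end
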